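import Literature.MathematicalPhysics.QuantumLattice.OverlapLocality
import Literature.MathematicalPhysics.QuantumLattice.LatticeToriProofs
import Summits.QuantumFields.QCD.Theorems.HeatSlicedQuarksDaviesGaffneyWilsonRange

/-!
# Naive kinetic bound for Wilson fermions, I: quadratic forms, Schur test, unitary defects
(auxiliary file for stub `stub_naiveKinetic` of line `Sketch`, crux `ActionBoundsLowModes`,
item stmt-QuantumFields-8872, route route-QuantumFields-HeatSlicedQuarks)

Generic, gauge-field-free estimates used by the naive kinetic bound
`Re⟨v, T_naive(U) v⟩ ≤ 4 ‖D_W v‖² + C Σ_x V(U,x) |v(x)|²` (files `…StubNaiveKineticDefects.lean`,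
`…StubNaiveKinetic.lean`):

* `ℓ²` bookkeeping for quadratic forms `⟨w, X w⟩ = star w ⬝ᵥ (X *ᵥ w)` of complex matrices:
  `Σ‖Xw‖² = Re⟨w, XᴴXw⟩`, `conj⟨w,Xw⟩ = ⟨w,Xᴴw⟩`, the polarised square
  `‖(M+A)w‖² = ‖Mw‖² + ‖Aw‖² + Re⟨w,(MA−AM)w⟩` for `Mᴴ = M`, `Aᴴ = −A`
  (`sum_norm_sq_mulVec_add_of_comm`);
* the **Schur test** `|⟨w,Bw⟩| ≤ Σ_i (row_i|B| + col_i|B|)|w_i|²` (`norm_form_le_rowcol`) and its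
  Kronecker form for `Z ⊗ Γ` with a spin matrix `|Γ_{αβ}| ≤ 1` (`stub_naiveKineticSchur`, the
  registered sub-goal of this file);
* entries of **unitary defects**: `Σ_{cd}|(P−1)_{cd}|² = 2(N − Re tr P)` for unitary `P`
  (`sum_norm_sq_sub_one_apply`), hence `|(W₁(P−1)W₂)_{ab}| ≤ 2N²√(N − Re tr P)`;
* torus distances of shifted base points (`torusDist x (x − μ̂) ≤ 3`, `torusDist x (x − μ̂ − ν̂) ≤ 3`).

All statements are elementary (finite sums, Cauchy–Schwarz-free AM–GM); no named facts are used.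
-/

namespace Summit.QuantumFields.QCD.Cruxes.ActionBoundsLowModes.DropTheWilsonSquare

open Literature.MathematicalPhysics Literature.MathematicalPhysics.QuantumLattice
  Literature.MathematicalPhysics.QuantumFieldTheory Literature.Probability.LatticeModels
open Matrix
open scoped Kronecker ComplexOrder

/-! ## Quadratic forms `⟨w, X w⟩` on `ℓ²` -/

section Forms

variable {ι : Type*} [Fintype ι]

/-- `Σ_i ‖u i‖² = Re⟨u, u⟩`. -/
theorem sum_norm_sq_eq_re_dot (u : ι → ℂ) : ∑ i, ‖u i‖ ^ 2 = (star u ⬝ᵥ u).re := by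
  rw [dotProduct, Complex.re_sum]
  refine Finset.sum_congr rfl fun i _ => ?_
  rw [Pi.star_apply, Complex.star_def, ← Complex.normSq_eq_conj_mul_self, Complex.ofReal_re,
    Complex.normSq_eq_norm_sq]

/-- `⟨M w, A w⟩ = ⟨w, Mᴴ A w⟩`. -/
theorem star_mulVec_dotProduct_mulVec (M A : Matrix ι ι ℂ) (w : ι → ℂ) :
    star (M *ᵥ w) ⬝ᵥ (A *ᵥ w) = star w ⬝ᵥ ((Mᴴ * A) *ᵥ w) := by
  rw [star_mulVec, ← dotProduct_mulVec, mulVec_mulVec]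

/-- `Σ_i ‖(X w) i‖² = Re⟨w, Xᴴ X w⟩`. -/
theorem sum_norm_sq_mulVec (X : Matrix ι ι ℂ) (w : ι → ℂ) :
    ∑ i, ‖(X *ᵥ w) i‖ ^ 2 = (star w ⬝ᵥ ((Xᴴ * X) *ᵥ w)).re := by
  rw [sum_norm_sq_eq_re_dot, star_mulVec_dotProduct_mulVec]

/-- `conj ⟨w, X w⟩ = ⟨w, Xᴴ w⟩`. -/
theorem star_form (X : Matrix ι ι ℂ) (w : ι → ℂ) :
    star (star w ⬝ᵥ (X *ᵥ w)) = star w ⬝ᵥ (Xᴴ *ᵥ w) := by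
  rw [← star_dotProduct_star, star_star, star_mulVec, ← dotProduct_mulVec]

/-- `‖u + u'‖² = ‖u‖² + ‖u'‖² + 2 Re⟨u, u'⟩` in `ℓ²`. -/
theorem sum_norm_sq_add (u u' : ι → ℂ) :
    ∑ i, ‖(u + u') i‖ ^ 2 = ∑ i, ‖u i‖ ^ 2 + ∑ i, ‖u' i‖ ^ 2 + 2 * (star u ⬝ᵥ u').re := by
  rw [dotProduct, Complex.re_sum, Finset.mul_sum, ← Finset.sum_add_distrib,
    ← Finset.sum_add_distrib]
  refine Finset.sum_congr rfl fun i _ => ?_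
  rw [Pi.add_apply, Pi.star_apply, ← Complex.normSq_eq_norm_sq, ← Complex.normSq_eq_norm_sq,
    ← Complex.normSq_eq_norm_sq, Complex.normSq_add, Complex.star_def]
  have : (u i * (starRingEnd ℂ) (u' i)).re = ((starRingEnd ℂ) (u i) * u' i).re := by
    rw [← Complex.conj_re (u i * _), map_mul, Complex.conj_conj]
  rw [this]

/-- **Polarised square**: for `Mᴴ = M` and `Aᴴ = -A`,
`‖(M + A) w‖² = ‖M w‖² + ‖A w‖² + Re⟨w, (MA − AM) w⟩`. -/
theorem sum_norm_sq_mulVec_add_of_comm (M A : Matrix ι ι ℂ) (hM : Mᴴ = M) (hA : Aᴴ = -A)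
    (w : ι → ℂ) :
    ∑ i, ‖((M + A) *ᵥ w) i‖ ^ 2 =
      ∑ i, ‖(M *ᵥ w) i‖ ^ 2 + ∑ i, ‖(A *ᵥ w) i‖ ^ 2 +
        (star w ⬝ᵥ ((M * A - A * M) *ᵥ w)).re := by
  rw [add_mulVec, sum_norm_sq_add, star_mulVec_dotProduct_mulVec, hM]
  congr 1
  have h2 : ∀ z : ℂ, 2 * z.re = (z + star z).re := fun z => by
    rw [Complex.add_re, Complex.star_def, Complex.conj_re, two_mul]
  rw [h2, star_form, conjTranspose_mul, hM, hA, ← dotProduct_add, ← add_mulVec, neg_mul,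
    ← sub_eq_add_neg]

/-- `‖(c • X) w‖² = ‖c‖² ‖X w‖²`. -/
theorem sum_norm_sq_smul_mulVec (c : ℂ) (X : Matrix ι ι ℂ) (w : ι → ℂ) :
    ∑ i, ‖((c • X) *ᵥ w) i‖ ^ 2 = ‖c‖ ^ 2 * ∑ i, ‖(X *ᵥ w) i‖ ^ 2 := by
  rw [smul_mulVec, Finset.mul_sum]
  refine Finset.sum_congr rfl fun i _ => ?_
  rw [Pi.smul_apply, smul_eq_mul, norm_mul, mul_pow]

/-- **Schur test** for a quadratic form: `|⟨w, B w⟩| ≤ Σ_i (Σ_j |B i j| + Σ_j |B j i|) |w i|²`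
(from `|w̄_i B_ij w_j| ≤ |B_ij| (|w_i|² + |w_j|²)`). -/
theorem norm_form_le_rowcol (B : Matrix ι ι ℂ) (w : ι → ℂ) :
    ‖star w ⬝ᵥ (B *ᵥ w)‖ ≤ ∑ i, ((∑ j, ‖B i j‖) + ∑ j, ‖B j i‖) * ‖w i‖ ^ 2 := by
  calc ‖star w ⬝ᵥ (B *ᵥ w)‖ = ‖∑ i, star (w i) * ∑ j, B i j * w j‖ := rfl
    _ ≤ ∑ i, ∑ j, ‖B i j‖ * (‖w i‖ * ‖w j‖) := by
        refine (norm_sum_le _ _).trans (Finset.sum_le_sum fun i _ => ?_)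
        rw [norm_mul, norm_star]
        refine (mul_le_mul_of_nonneg_left (norm_sum_le _ _) (norm_nonneg _)).trans (le_of_eq ?_)
        rw [Finset.mul_sum]
        exact Finset.sum_congr rfl fun j _ => by rw [norm_mul]; ring
    _ ≤ ∑ i, ∑ j, (‖B i j‖ * ‖w i‖ ^ 2 + ‖B i j‖ * ‖w j‖ ^ 2) := by
        refine Finset.sum_le_sum fun i _ => Finset.sum_le_sum fun j _ => ?_
        have h := two_mul_le_add_sq (‖w i‖) (‖w j‖)
        have hB := norm_nonneg (B i j)
        nlinarith
    _ = ∑ i, ((∑ j, ‖B i j‖) + ∑ j, ‖B j i‖) * ‖w i‖ ^ 2 := by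
        simp only [Finset.sum_add_distrib]
        rw [Finset.sum_comm (f := fun i j => ‖B i j‖ * ‖w j‖ ^ 2), ← Finset.sum_add_distrib]
        refine Finset.sum_congr rfl fun i _ => ?_
        rw [add_mul, Finset.sum_mul, Finset.sum_mul]

end Forms

/-! ## Kronecker products with a spin matrix -/

section Kron

variable {n : Type*} [Fintype n]

/-- Row sums of `|Z ⊗ Γ|` for a `4 × 4` matrix `Γ` with entries of modulus `≤ 1`. -/
theorem sum_norm_kronecker_row_le (Z : Matrix n n ℂ) (Γ : Matrix (Fin 4) (Fin 4) ℂ)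
    (hΓ : ∀ α β, ‖Γ α β‖ ≤ 1) (i : n × Fin 4) :
    ∑ j, ‖(Z ⊗ₖ Γ) i j‖ ≤ 4 * ∑ q, ‖Z i.1 q‖ := by
  rw [Fintype.sum_prod_type, Finset.mul_sum]
  refine Finset.sum_le_sum fun q _ => ?_
  calc ∑ β, ‖(Z ⊗ₖ Γ) i (q, β)‖ ≤ ∑ _β : Fin 4, ‖Z i.1 q‖ :=
        Finset.sum_le_sum fun β _ => by
          rw [Matrix.kroneckerMap_apply, norm_mul]
          exact mul_le_of_le_one_right (norm_nonneg _) (hΓ _ _)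
    _ = 4 * ‖Z i.1 q‖ := by simp

/-- Column sums of `|Z ⊗ Γ|` for a `4 × 4` matrix `Γ` with entries of modulus `≤ 1`. -/
theorem sum_norm_kronecker_col_le (Z : Matrix n n ℂ) (Γ : Matrix (Fin 4) (Fin 4) ℂ)
    (hΓ : ∀ α β, ‖Γ α β‖ ≤ 1) (i : n × Fin 4) :
    ∑ j, ‖(Z ⊗ₖ Γ) j i‖ ≤ 4 * ∑ q, ‖Z q i.1‖ := by
  rw [Fintype.sum_prod_type, Finset.mul_sum]
  refine Finset.sum_le_sum fun q _ => ?_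
  calc ∑ β, ‖(Z ⊗ₖ Γ) (q, β) i‖ ≤ ∑ _β : Fin 4, ‖Z q i.1‖ :=
        Finset.sum_le_sum fun β _ => by
          rw [Matrix.kroneckerMap_apply, norm_mul]
          exact mul_le_of_le_one_right (norm_nonneg _) (hΓ _ _)
    _ = 4 * ‖Z q i.1‖ := by simp

/-- **Schur test for `Z ⊗ Γ`** (`|Γ_{αβ}| ≤ 1`), the registered sub-goal of this file:
`|⟨w, (Z ⊗ Γ) w⟩| ≤ 4 Σ_p (Σ_q |Z p q| + Σ_q |Z q p|) Σ_α |w(p,α)|²`. -/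
theorem stub_naiveKineticSchur : ∀ {n : Type} [Fintype n] (Z : Matrix n n ℂ) (Γ : Matrix (Fin 4) (Fin 4) ℂ), (∀ α β, ‖Γ α β‖ ≤ 1) → ∀ (w : n × Fin 4 → ℂ), ‖star w ⬝ᵥ ((Z ⊗ₖ Γ) *ᵥ w)‖ ≤ 4 * ∑ p, ((∑ q, ‖Z p q‖) + ∑ q, ‖Z q p‖) * ∑ α, ‖w (p, α)‖ ^ 2 := by
  intro n _ Z Γ hΓ w
  refine (norm_form_le_rowcol _ w).trans ?_
  rw [Fintype.sum_prod_type, Finset.mul_sum]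
  refine Finset.sum_le_sum fun p _ => ?_
  rw [← mul_assoc, Finset.mul_sum]
  refine Finset.sum_le_sum fun α _ => mul_le_mul_of_nonneg_right ?_ (sq_nonneg _)
  have h1 := sum_norm_kronecker_row_le Z Γ hΓ (p, α)
  have h2 := sum_norm_kronecker_col_le Z Γ hΓ (p, α)
  linarith

end Kron

section KronAlgebra

variable {n : Type*}

/-- `(−Z) ⊗ Γ = −(Z ⊗ Γ)`. -/
theorem neg_kronecker {l m p : Type*} (A : Matrix l m ℂ) (B : Matrix n p ℂ) :
    (-A) ⊗ₖ B = -(A ⊗ₖ B) := by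
  ext ⟨i, j⟩ ⟨k, l⟩
  simp [Matrix.kroneckerMap_apply]

/-- `(Z₁ − Z₂) ⊗ Γ = Z₁ ⊗ Γ − Z₂ ⊗ Γ`. -/
theorem sub_kronecker {l m p : Type*} (A₁ A₂ : Matrix l m ℂ) (B : Matrix n p ℂ) :
    (A₁ - A₂) ⊗ₖ B = A₁ ⊗ₖ B - A₂ ⊗ₖ B := by
  ext ⟨i, j⟩ ⟨k, l⟩
  simp [Matrix.kroneckerMap_apply, sub_mul]

/-- `Z ⊗ (Γ₁ − Γ₂) = Z ⊗ Γ₁ − Z ⊗ Γ₂`. -/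
theorem kronecker_sub {l m p : Type*} (A : Matrix l m ℂ) (B₁ B₂ : Matrix n p ℂ) :
    A ⊗ₖ (B₁ - B₂) = A ⊗ₖ B₁ - A ⊗ₖ B₂ := by
  ext ⟨i, j⟩ ⟨k, l⟩
  simp [Matrix.kroneckerMap_apply, mul_sub]

/-- `(Σ_i Z_i) ⊗ Γ = Σ_i (Z_i ⊗ Γ)`. -/
theorem sum_kronecker {l m p κ : Type*} (s : Finset κ) (A : κ → Matrix l m ℂ) (B : Matrix n p ℂ) :
    (∑ i ∈ s, A i) ⊗ₖ B = ∑ i ∈ s, A i ⊗ₖ B := by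
  ext ⟨i, j⟩ ⟨k, l⟩
  simp [Matrix.kroneckerMap_apply, Matrix.sum_apply, Finset.sum_mul]

end KronAlgebra

/-! ## Unitary colour matrices: entries of plaquette defects -/

section Unitary

variable {N : ℕ}

/-- `|(W M)_{ab}| ≤ Σ_c |M_{cb}|` for unitary `W`. -/
theorem norm_unitary_mul_apply_le {W : Matrix (Fin N) (Fin N) ℂ}
    (hW : W ∈ Matrix.unitaryGroup (Fin N) ℂ) (M : Matrix (Fin N) (Fin N) ℂ) (a b : Fin N) :
    ‖(W * M) a b‖ ≤ ∑ c, ‖M c b‖ := by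
  rw [Matrix.mul_apply]
  refine (norm_sum_le _ _).trans (Finset.sum_le_sum fun c _ => ?_)
  rw [norm_mul]
  exact mul_le_of_le_one_left (norm_nonneg _) (entry_norm_bound_of_unitary hW a c)

/-- `|(M W)_{ab}| ≤ Σ_c |M_{ac}|` for unitary `W`. -/
theorem norm_mul_unitary_apply_le {W : Matrix (Fin N) (Fin N) ℂ}
    (hW : W ∈ Matrix.unitaryGroup (Fin N) ℂ) (M : Matrix (Fin N) (Fin N) ℂ) (a b : Fin N) :
    ‖(M * W) a b‖ ≤ ∑ c, ‖M a c‖ := by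
  rw [Matrix.mul_apply]
  refine (norm_sum_le _ _).trans (Finset.sum_le_sum fun c _ => ?_)
  rw [norm_mul]
  exact mul_le_of_le_one_right (norm_nonneg _) (entry_norm_bound_of_unitary hW c b)

/-- **Frobenius norm of a unitary defect**: `Σ_{c,d} |(P − 1)_{cd}|² = 2 (N − Re tr P)`. -/
theorem sum_norm_sq_sub_one_apply {P : Matrix (Fin N) (Fin N) ℂ}
    (hP : P ∈ Matrix.unitaryGroup (Fin N) ℂ) :
    ∑ c, ∑ d, ‖(P - 1) c d‖ ^ 2 = 2 * (N - P.trace.re) := by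
  have hrow : ∀ c, ∑ d, ‖P c d‖ ^ 2 = 1 := by
    intro c
    have h := congrFun (congrFun (Matrix.mem_unitaryGroup_iff.mp hP) c) c
    rw [Matrix.mul_apply, Matrix.one_apply_eq] at h
    have h' : ∑ d, ((‖P c d‖ ^ 2 : ℝ) : ℂ) = 1 := by
      rw [← h]
      refine Finset.sum_congr rfl fun d _ => ?_
      rw [Matrix.star_apply, Complex.star_def, Complex.mul_conj, Complex.normSq_eq_norm_sq]
    exact_mod_cast h'
  have key : ∀ c, ∑ d, ‖(P - 1) c d‖ ^ 2 = 2 - 2 * (P c c).re := by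
    intro c
    have e : ∀ d, ‖(P - 1) c d‖ ^ 2 =
        ‖P c d‖ ^ 2 + ‖(1 : Matrix (Fin N) (Fin N) ℂ) c d‖ ^ 2 -
          2 * (P c d * (starRingEnd ℂ) ((1 : Matrix (Fin N) (Fin N) ℂ) c d)).re := by
      intro d
      rw [Matrix.sub_apply, ← Complex.normSq_eq_norm_sq, ← Complex.normSq_eq_norm_sq,
        ← Complex.normSq_eq_norm_sq, Complex.normSq_sub]
    simp_rw [e, Finset.sum_sub_distrib, Finset.sum_add_distrib, hrow, Matrix.one_apply]
    simp [apply_ite, Finset.sum_ite_eq, one_add_one_eq_two]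
  rw [Finset.sum_congr rfl fun c _ => key c, Finset.sum_sub_distrib, ← Finset.mul_sum,
    Matrix.trace, Complex.re_sum]
  simp only [Finset.sum_const, Finset.card_univ, Fintype.card_fin, nsmul_eq_mul,
    Matrix.diag_apply]
  ring

/-- Each entry of a unitary defect: `|(P − 1)_{cd}| ≤ 2 √(N − Re tr P)`. -/
theorem norm_sub_one_apply_le {P : Matrix (Fin N) (Fin N) ℂ}
    (hP : P ∈ Matrix.unitaryGroup (Fin N) ℂ) (c d : Fin N) :
    ‖(P - 1) c d‖ ≤ 2 * Real.sqrt (N - P.trace.re) := by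
  have hle : ‖(P - 1) c d‖ ^ 2 ≤ 2 * (N - P.trace.re) := by
    rw [← sum_norm_sq_sub_one_apply hP]
    exact (Finset.single_le_sum (f := fun d => ‖(P - 1) c d‖ ^ 2) (fun _ _ => sq_nonneg _)
      (Finset.mem_univ d)).trans
      (Finset.single_le_sum (f := fun c => ∑ d, ‖(P - 1) c d‖ ^ 2)
        (fun _ _ => Finset.sum_nonneg fun _ _ => sq_nonneg _) (Finset.mem_univ c))
  calc ‖(P - 1) c d‖ = Real.sqrt (‖(P - 1) c d‖ ^ 2) := (Real.sqrt_sq (norm_nonneg _)).symm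
    _ ≤ Real.sqrt (2 ^ 2 * (N - P.trace.re)) :=
        Real.sqrt_le_sqrt (by nlinarith [sq_nonneg ‖(P - 1) c d‖])
    _ = 2 * Real.sqrt (N - P.trace.re) := by
        rw [Real.sqrt_mul (by norm_num), Real.sqrt_sq (by norm_num)]

/-- **Entries of a conjugated defect**: for unitary `W₁, W₂, P`,
`|(W₁ (P − 1) W₂)_{ab}| ≤ 2 N² √(N − Re tr P)`. -/
theorem norm_conj_defect_apply_le {W₁ W₂ P : Matrix (Fin N) (Fin N) ℂ}
    (hW₁ : W₁ ∈ Matrix.unitaryGroup (Fin N) ℂ) (hW₂ : W₂ ∈ Matrix.unitaryGroup (Fin N) ℂ)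
    (hP : P ∈ Matrix.unitaryGroup (Fin N) ℂ) (a b : Fin N) :
    ‖(W₁ * (P - 1) * W₂) a b‖ ≤ 2 * N ^ 2 * Real.sqrt (N - P.trace.re) := by
  rw [mul_assoc]
  calc ‖(W₁ * ((P - 1) * W₂)) a b‖ ≤ ∑ c, ‖((P - 1) * W₂) c b‖ :=
        norm_unitary_mul_apply_le hW₁ _ a b
    _ ≤ ∑ c, ∑ d, ‖(P - 1) c d‖ :=
        Finset.sum_le_sum fun c _ => norm_mul_unitary_apply_le hW₂ _ c b
    _ ≤ ∑ _c : Fin N, ∑ _d : Fin N, 2 * Real.sqrt (N - P.trace.re) :=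
        Finset.sum_le_sum fun c _ => Finset.sum_le_sum fun d _ => norm_sub_one_apply_le hP c d
    _ = 2 * N ^ 2 * Real.sqrt (N - P.trace.re) := by simp; ring

/-- Entries of the `SU(3)` defect `W₁ (ρ₃(U_□) − 1) ρ₃(g₂)` (`W₁ = ρ₃(g₁)` or `ρ₃(g₁)ᴴ`, `ρ₃` the
fundamental representation): at most `18 √(3 − Re tr ρ₃(U_□))`. -/
theorem norm_su3_defect_apply_le (g₁ g₂ hol : Matrix.specialUnitaryGroup (Fin 3) ℂ)
    (W₁ : Matrix (Fin 3) (Fin 3) ℂ)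
    (hW₁ : W₁ = fundamentalRep (Fin 3) g₁ ∨ W₁ = (fundamentalRep (Fin 3) g₁)ᴴ) (a b : Fin 3) :
    ‖(W₁ * (fundamentalRep (Fin 3) hol - 1) * fundamentalRep (Fin 3) g₂) a b‖ ≤
      18 * Real.sqrt (3 - (fundamentalRep (Fin 3) hol).trace.re) := by
  have hW : W₁ ∈ Matrix.unitaryGroup (Fin 3) ℂ := by
    rcases hW₁ with h | h
    · rw [h]; exact fundamentalRep_mem_unitaryGroup g₁
    · rw [h, ← star_eq_conjTranspose]
      exact Unitary.star_mem (fundamentalRep_mem_unitaryGroup g₁)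
  have h := norm_conj_defect_apply_le hW (fundamentalRep_mem_unitaryGroup g₂)
    (fundamentalRep_mem_unitaryGroup hol) a b
  simpa only [Nat.cast_ofNat, show (2 : ℝ) * 3 ^ 2 = 18 by norm_num] using h

/-- Entries of `(ρ₃(U_□) − 1) ρ₃(g) ρ₃(g')`: at most `18 √(3 − Re tr ρ₃(U_□))`. -/
theorem norm_defect_mul_apply_le (hol g g' : Matrix.specialUnitaryGroup (Fin 3) ℂ) (a b : Fin 3) :
    ‖((fundamentalRep (Fin 3) hol - 1) * (fundamentalRep (Fin 3) g * fundamentalRep (Fin 3) g'))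
        a b‖ ≤ 18 * Real.sqrt (3 - (fundamentalRep (Fin 3) hol).trace.re) := by
  have h := norm_su3_defect_apply_le 1 (g * g') hol 1 (Or.inl (map_one _).symm) a b
  rwa [one_mul, map_mul] at h

end Unitary

/-! ## Torus distances of the base points -/

section Torus

variable {L : ℕ} [NeZero L]

/-- A unit lattice vector has torus norm `≤ 1`. -/
theorem torusNorm_single_le (μ : Fin 4) :
    torusNorm (Pi.single μ (1 : ZMod L) : TorusSite 4 L) ≤ 1 := by
  have h := Summit.QuantumFields.QCD.Theorems.HeatSlicedQuarksDaviesGaffney.torusDist_shift_self_le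
    (0 : TorusSite 4 L) μ
  rwa [torusDist, QuantumFieldTheory.Site.shift, zero_add, sub_zero] at h

omit [NeZero L] in
/-- `dist(x, x − s) = ‖s‖` on the torus. -/
theorem torusDist_self_sub (x s : TorusSite 4 L) : torusDist x (x - s) = torusNorm s := by
  rw [torusDist, sub_sub_cancel]

/-- `dist(x, x − ν̂) ≤ 3`. -/
theorem torusDist_sub_single_le (x : TorusSite 4 L) (ν : Fin 4) :
    torusDist x (x - Pi.single ν 1) ≤ 3 := by
  rw [torusDist_self_sub]
  exact (torusNorm_single_le ν).trans (by norm_num)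

/-- `dist(x, x − (μ̂ + ν̂)) ≤ 3`. -/
theorem torusDist_sub_single_add_single_le (x : TorusSite 4 L) (μ ν : Fin 4) :
    torusDist x (x - (Pi.single μ 1 + Pi.single ν 1)) ≤ 3 := by
  rw [torusDist_self_sub]
  exact (torusNorm_add_le _ _).trans
    ((add_le_add (torusNorm_single_le μ) (torusNorm_single_le ν)).trans (by norm_num))

end Torus

end Summit.QuantumFields.QCD.Cruxes.ActionBoundsLowModes.DropTheWilsonSquare
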